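import Literature.AnabelianGeometry.SemiGraphs.ArithmeticCoverings
import Literature.AnabelianGeometry.SemiGraphs.ArithSemiGraphNonVacuity
import Literature.AnabelianGeometry.SemiGraphs.AmbientVocabDictionary
import Mathlib.Topology.Instances.ZMod
import HarnessLib

/-!
# [SemiAnbd] Thm 5.4 (iii) as the PARAMETRISED schema `ArithQuasiGeometricCorrespondenceStatement 𝔊 ℍ e augG augH btemp`:
# the universal closure is false — free-parameter witness at every carrier (FACT-LIST F-1922)

Mochizuki, *Semi-graphs of anabelioids*, Publ. RIMS **42** (2006) 221–322, §5, Theorem 5.4 (iii), author's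
manuscript p. 66: "applying `B^temp(−)` determines a natural bijective correspondence between locally open
morphisms `𝔊 → ℍ` over `A` and arithmetically quasi-geometric morphisms of temperoids `B^temp(𝔊) → B^temp(ℍ)`
over `A^⊤`" [cite: MochizukiSemiAnbd2006, Thm 5.4 (iii), p. 66]; Def 5.3 (i) p. 65 (arithmetically ample /
arithmetically maximal compact subgroups).

PROOF-ONLY companion (no definitions, no instances, no new named fact) of abc-iut-L3-t3's
`ArithmeticCoverings.lean` (the typed statement `ArithQuasiGeometricCorrespondenceStatement`, FROZEN shape
p407115) and `ArithMaximalCompact.lean` (`IsArithQuasiGeometric`); abc-iut cell, layer L3, seat abc-iut-L3-d2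
(gen 9), director KEY «F1487/F-1922», L3-lead δ20.  FACT-LIST row **F-1922** (`kernel_closedness =
parametrised`, label «conditional», LF-KERNEL-STATUS 2026-08-27T06:43Z «LABEL-OPEN, conditional/instance
only»).  House genre: `Tempered*SchemaNegative.lean` (block F) / `AbsAnabGeomPredicatesSchemaNegative.lean`.

WHAT THE TYPED DECLARATION IS.  Its own docstring: "Thm 5.4 (iii) (conclusion, as a predicate on explicit
data) … Not asserted for arbitrary data".  The candidate arithmetic tempered fundamental groups `Gtp`, `Htp`,
their augmentations `augG : Gtp →* Π_A`, `augH : Htp →* Π_{A′}` and the map "apply `B^temp(−)`" `btemp` are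
FREE PARAMETERS of the declaration (their producers — `π₁^temp` of the connected temperoid `B^temp(𝔊)`,
Prop 3.6 (iv) functoriality — are separate rows of the sub-DAG `SUBDAG-SemiAnbd-Thm54.md`).  Consequently
the universal closure of the declaration quantifies over data print never speaks about, and is false for
parameter reasons alone:

* `isArithQuasiGeometric_one_of_discreteTopology` — over a DISCRETE candidate group `G` with EQUAL
  augmentations on both sides, the TRIVIAL homomorphism `1 : G → G` is arithmetically quasi-geometric in
  the LITERAL sense of `IsArithQuasiGeometric` (each arithmetically maximal compact `K₁`, resp. ample pair
  `K₁ ∩ H₁`, is sent onto the subgroup `1`, which is open in the discrete `K₂ := K₁`, resp. `K₂ ∩ H₂ :=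
  K₁ ∩ H₁`);
* `not_arithQuasiGeometricCorrespondenceStatement_of_free_parameters` — hence at EVERY carrier
  `𝔊 : ArithSemiGraph 𝓥` (every vocabulary `𝓥`), with `ℍ := 𝔊`, `e := 1`, `Gtp = Htp := ℤ/2` (discrete,
  written multiplicatively), `augG = augH := 1` and `btemp := id`, clause (3) of the statement ("every
  arithmetically quasi-geometric `f` is an inner conjugate of some `B^temp(φ)`") fails: `1` is not a
  conjugate of `id` on `ℤ/2`;
* `not_forall_arithQuasiGeometricCorrespondenceStatement` — so the UNIVERSAL CLOSURE of F-1922 is FALSE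
  (stated at the universes of the tree's real-vocabulary carrier `ArithSemiGraph.nonempty_ofReal`,
  abc-iut-w6-d117: Example 2.10 on the one-vertex graph with the one-point arithmetic component).

LOAD-BEARING PARAMETER.  The witness keeps `𝔊`, `ℍ`, `e` honest (any carrier) and breaks the statement
through the candidate-group / `btemp` parameters only: the row is meaningful AT THE NAMED INSTANCE ONLY —
`Gtp := π₁^temp(𝔾) ⋊^out Π_A` with the canonical `B^temp` (the outer models of abc-iut-w4-d089 /
abc-iut-w4-d071).  There the kernel state of record is UNTOUCHED by this file: the COMPATIBLE reading of
(iii) is PROVED (`arithThm54IntegratedChart…` v6 p457403, `ArithQuasiGeometricCorrespondenceStatementCompat`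
of abc-iut-w4-d083), the LITERAL reading (this decl) holds there iff the displayed hypothesis `hdist`
(`arithQuasiGeometricCorrespondenceStatement_outerModels_of_hdist`, p463212; GAP-LEDGER G-w4d089-g9-1), and
one collapsing literally-quasi-geometric `f` refutes it (`not_arithQuasiGeometricCorrespondenceStatement_of_
collapse`, p463609) — a carrier question (genuine Ex 5.6 carrier with an edge), not addressed here.

HONEST LABEL: refuted-CLOSURE ≠ refuted-paper (print's statement is about `π₁^temp` of `B^temp(𝔊)` under the
Thm 5.4 frame: connected, countable, totally elevated, totally arithmetically estranged, no branch switching);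
a schema refutation says only that the ∀-form of the typed predicate cannot be assumed; instance forms are
the content.  Typed ≠ proved; nothing here takes a side on [IUTchIII] Cor. 3.12; nothing here asserts abc
proved or refuted.
-/

noncomputable section

namespace Literature.AnabelianGeometry.SemiGraphs

open _root_.CategoryTheory _root_.Topology

universe u v w

/-! ### The trivial homomorphism of a discrete candidate group is literally arithmetically quasi-geometric -/

section Discrete

variable {G : Type*} [Group G] [TopologicalSpace G] [DiscreteTopology G]
variable {PA : Type*} [Group PA] [TopologicalSpace PA]

/-- In a discrete group the trivial homomorphism "maps `K₁` onto an open subgroup of `K₂`" for ALL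
subgroups `K₁`, `K₂` (the image is `1`, open in the discrete `K₂`). [cite: MochizukiSemiAnbd2006, Thm 5.4 (iii), p. 66] -/
theorem mapsOntoOpenSubgroupOf_one_of_discreteTopology (K₁ K₂ : Subgroup G) :
    MapsOntoOpenSubgroupOf (1 : G →* G) K₁ K₂ := by
  refine ⟨?_, isOpen_discrete _⟩
  rintro x ⟨k, -, rfl⟩
  rw [MonoidHom.one_apply]
  exact one_mem K₂

/-- **The trivial homomorphism is LITERALLY arithmetically quasi-geometric** for a discrete candidate group
`G` with the trivial augmentation on both sides: it is continuous, compatible with the augmentations, and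
sends every arithmetically maximal compact `K₁` (resp. arithmetically ample meet `K₁ ∩ H₁` of two distinct
ones) onto the open subgroup `1` of `K₂ := K₁` (resp. of `K₂ ∩ H₂ := K₁ ∩ H₁`) — Def 5.3 (i) / Thm 5.4 (iii)
read on free candidate data. [cite: MochizukiSemiAnbd2006, Thm 5.4 (iii), p. 66] -/
theorem isArithQuasiGeometric_one_of_discreteTopology :
    IsArithQuasiGeometric (1 : G →* PA) (1 : G →* PA) (1 : G →* G) := by
  refine ⟨continuous_of_discreteTopology, MonoidHom.comp_one _, fun K₁ hK₁ => ?_,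
    fun K₁ H₁ hK₁ hH₁ hne ha => ?_⟩
  · exact ⟨K₁, hK₁, mapsOntoOpenSubgroupOf_one_of_discreteTopology K₁ K₁⟩
  · exact ⟨K₁, H₁, hK₁, hH₁, hne, ha, mapsOntoOpenSubgroupOf_one_of_discreteTopology _ _⟩

end Discrete

/-! ### The schema fails at every carrier -/

section AnyCarrier

variable {Obj : Type u} [Category.{v} Obj] {𝓥 : SemiAnbdVocab.{u, v, w} Obj}

/-- **F-1922 with free parameters fails at EVERY carrier**: for any `𝔊 : ArithSemiGraph 𝓥`, with `ℍ := 𝔊`,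
`e := 1`, candidate groups `Gtp = Htp := ℤ/2` (discrete), trivial augmentations and `btemp := id`, the typed
`ArithQuasiGeometricCorrespondenceStatement` is false: by `isArithQuasiGeometric_one_of_discreteTopology` the
trivial homomorphism is literally arithmetically quasi-geometric, but clause (3) would make it an inner
conjugate `h · id · h⁻¹ = id` of `btemp φ = id`, and `1 ≠ id` on `ℤ/2`.  (Print's (iii) is about
`Π^temp_𝔊 = π₁^temp(B^temp(𝔊))` and the canonical `B^temp`, not about these parameters.)
[cite: MochizukiSemiAnbd2006, Thm 5.4 (iii), p. 66] -/
theorem not_arithQuasiGeometricCorrespondenceStatement_of_free_parameters (𝔊 : ArithSemiGraph 𝓥) :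
    ¬ ArithQuasiGeometricCorrespondenceStatement 𝔊 𝔊 (MulEquiv.refl _)
        (1 : Multiplicative (ZMod 2) →* 𝔊.PA) (1 : Multiplicative (ZMod 2) →* 𝔊.PA)
        (fun _ _ _ => MonoidHom.id (Multiplicative (ZMod 2))) := by
  intro h
  dsimp only [ArithQuasiGeometricCorrespondenceStatement] at h
  obtain ⟨-, -, h3⟩ := h
  have haqg : IsArithQuasiGeometric (1 : Multiplicative (ZMod 2) →* 𝔊.PA)
      ((MulEquiv.refl (𝔊.PA : Type w)).symm.toMonoidHom.comp (1 : Multiplicative (ZMod 2) →* 𝔊.PA))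
      (1 : Multiplicative (ZMod 2) →* Multiplicative (ZMod 2)) := by
    rw [MonoidHom.comp_one]
    exact isArithQuasiGeometric_one_of_discreteTopology
  obtain ⟨φ, h₁, h₂, g, hg⟩ := h3 1 haqg
  have key := hg (Multiplicative.ofAdd 1)
  rw [MonoidHom.one_apply, MonoidHom.id_apply, mul_comm g, mul_inv_cancel_right] at key
  exact absurd key (by decide)

/-- The same, in `∃`-form over the parameters: every carrier has SOME candidate data `(Gtp, Htp, augG, augH,
btemp)` — here in universe `0` — at which the schema fails. [cite: MochizukiSemiAnbd2006, Thm 5.4 (iii), p. 66] -/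
theorem exists_parameters_not_arithQuasiGeometricCorrespondenceStatement (𝔊 : ArithSemiGraph 𝓥) :
    ∃ (Gtp : Type) (_ : Group Gtp) (_ : TopologicalSpace Gtp) (augG : Gtp →* 𝔊.PA)
      (btemp : (φ : ArithHom 𝓥 𝔊 𝔊) → φ.IsLocallyOpen → ArithHom.IsOverA 𝔊 𝔊 (MulEquiv.refl _) φ →
        (Gtp →* Gtp)),
      ¬ ArithQuasiGeometricCorrespondenceStatement 𝔊 𝔊 (MulEquiv.refl _) augG augG btemp :=
  ⟨Multiplicative (ZMod 2), inferInstance, inferInstance, 1, fun _ _ _ => MonoidHom.id _,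
    not_arithQuasiGeometricCorrespondenceStatement_of_free_parameters 𝔊⟩

end AnyCarrier

/-! ### The universal closure of F-1922 is false -/

/-- **FACT-LIST F-1922: the universal closure of `ArithQuasiGeometricCorrespondenceStatement` is FALSE** (at
the universes of the tree's real-vocabulary carrier): instantiate at abc-iut-w6-d117's
`ArithSemiGraph.nonempty_ofReal` (Example 2.10 on the one-vertex graph, one-point arithmetic component, over
`SemiAnbdVocab.ofReal`) and the free-parameter witness
`not_arithQuasiGeometricCorrespondenceStatement_of_free_parameters`.  So the row is admissible / meaningful
AT THE NAMED INSTANCE ONLY (outer models with the canonical `B^temp`: COMPATIBLE reading PROVED p457403;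
LITERAL reading ⟺ `hdist`, p463212 / p463609) — untouched.  Refuted-closure ≠ refuted-paper.
[cite: MochizukiSemiAnbd2006, Thm 5.4 (iii), p. 66] -/
theorem not_forall_arithQuasiGeometricCorrespondenceStatement :
    ¬ ∀ {Obj : Type 2} [Category.{2} Obj] {𝓥 : SemiAnbdVocab.{2, 2, 0} Obj}
        (𝔊 ℍ : ArithSemiGraph 𝓥) (e : 𝔊.PA ≃* ℍ.PA)
        {Gtp : Type} [Group Gtp] [TopologicalSpace Gtp] {Htp : Type} [Group Htp] [TopologicalSpace Htp]
        (augG : Gtp →* 𝔊.PA) (augH : Htp →* ℍ.PA)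
        (btemp : (φ : ArithHom 𝓥 𝔊 ℍ) → φ.IsLocallyOpen → ArithHom.IsOverA 𝔊 ℍ e φ → (Gtp →* Htp)),
        ArithQuasiGeometricCorrespondenceStatement 𝔊 ℍ e augG augH btemp := by
  intro h
  obtain ⟨𝔊⟩ := ArithSemiGraph.nonempty_ofReal SgAQuot.SgA.BridgeResidual.trivial.{0, 1, 0}
  exact not_arithQuasiGeometricCorrespondenceStatement_of_free_parameters 𝔊 (h 𝔊 𝔊 _ _ _ _)

end Literature.AnabelianGeometry.SemiGraphs

end
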